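import Summits.Ventures.Crystal3D.Theorems.StickyWulffConstantGenericWallFloorInnerFaceBound
import Summits.Ventures.Crystal3D.Theorems.StickyWulffConstantNoReconstructionGainSymmetry
import Summits.Ventures.Crystal3D.StickySpheres.FinsetBridge
import HarnessLib

/-!
# The zero-charge wall floor: a clamped bicrystal cell costs at least its two outer faces

HONEST FRAMING. Part of the venture `Summits/Ventures/Crystal3D` (cell `crystal3d-full`), helper
`--supports` the crux `GenericWallFloor` (stmt-Ventures-19480, route
`route-Ventures-StickyWulffConstant`, line `WallLedgerG`, stub `stub_twoSlabAdhesion`).  The crux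
charges a NON-co-axial wall one unit of area: `6N − C ≥ (φ₁ + φ₂ + 1) π ρ² − C (1+h) ρ`.  This file
lands the `c₀ = 0` member of that family, for EVERY pair of lattices and EVERY filling (lattice,
twinned, amorphous), unconditionally:

* `cross_le_innerFace_ceiling` — the top-clamp twin of `cross_le_innerFace_floor`
  (`…InnerFaceBound`), by the mirror `x₂ ↦ −x₂` (`(ℝ ∙ e₃)ᗮ.reflection`);
* `two_mul_contactDeficiency_ge_cross` — kissing bookkeeping: the filling's own deficiency is at
  least half its contacts with the (disjoint) clamped samples, `2 D(Y) ≥ cross(Q, Y)`;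
* `twoSlabAdhesion_zeroCharge` — **zero-charge two-slab adhesion**: in the vocabulary of the
  registered stub `TwoSlabAdhesion` but with NO co-axiality hypothesis and charge `0` instead of
  `1`: `cross(P₁, X∖P₁) + cross(P₂, Y) ≤ D(Y) + (φ₁ + φ₂) π ρ² + C (1 + h) ρ` (`R₀ = 3`);
* `genericWallFloor_zeroCharge` — **zero-charge wall floor** in the vocabulary of the crux
  `GenericWallFloor` (composition with the landed `stub_affineSampleDeficit`, as in the registered
  skeleton `GenericWallFloor_holds_of_stubs`): for every pair `(A₁,t₁), (A₂,t₂)` there are `C, R₀`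
  with `(φ(A₁⁻¹e₃) + φ(A₂⁻¹e₃)) π ρ² − C (1+h) ρ ≤ 6N − numContacts x` in every clamped cylinder
  cell.

So the whole difficulty of the crux is the ONE extra unit of area; this file certifies the
baseline it is measured from (sealing of the outer faces + exact outer-face accounting).
WHAT THIS IS NOT: the crux (`c₀ = 1` for non-co-axial pairs); rung F-C1 not moved.
-/

noncomputable section

namespace Summit.Ventures.Crystal3D.Theorems

open Summit.Ventures.Crystal3D Finset
open Literature.MathematicalPhysics.StatisticalMechanics (barlowPos fccStacking constHagg
  barlowPos_mem contactDeficiency orderedContacts IsHaggSeq barlowStacking)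
open scoped InnerProductSpace

/-! ## The mirror `x₂ ↦ −x₂` -/

/-- Coordinates of the mirror in the horizontal plane: `(σ v)₂ = −v₂`, `(σ v)₀ = v₀`,
`(σ v)₁ = v₁`. -/
theorem reflection_e3_apply (v : EuclideanSpace ℝ (Fin 3)) :
    ((ℝ ∙ EuclideanSpace.single (2 : Fin 3) (1 : ℝ))ᗮ.reflection v) 2 = -v 2 ∧
    ((ℝ ∙ EuclideanSpace.single (2 : Fin 3) (1 : ℝ))ᗮ.reflection v) 0 = v 0 ∧
    ((ℝ ∙ EuclideanSpace.single (2 : Fin 3) (1 : ℝ))ᗮ.reflection v) 1 = v 1 := by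
  have he₃n : ‖EuclideanSpace.single (2 : Fin 3) (1 : ℝ)‖ = 1 := by
    rw [PiLp.norm_single, norm_one]
  rw [bondReflection_apply _ v he₃n, EuclideanSpace.inner_single_left]
  refine ⟨?_, ?_, ?_⟩
  · simp; ring
  · simp
  · simp

/-- The mirror flips `e₃`. -/
theorem reflection_e3_single :
    (ℝ ∙ EuclideanSpace.single (2 : Fin 3) (1 : ℝ))ᗮ.reflection
        (EuclideanSpace.single (2 : Fin 3) 1) = -EuclideanSpace.single (2 : Fin 3) (1 : ℝ) :=
  Submodule.reflection_orthogonalComplement_singleton_eq_neg _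

/-- Cross-contact counts are invariant under a linear isometry applied to both sets. -/
theorem card_crossContacts_image (σ : EuclideanSpace ℝ (Fin 3) ≃ₗᵢ[ℝ] EuclideanSpace ℝ (Fin 3))
    (P Q : Finset (EuclideanSpace ℝ (Fin 3))) :
    ((((P.image σ ×ˢ Q.image σ).filter fun pq => dist pq.1 pq.2 = 1).card : ℕ) : ℝ) =
      ((((P ×ˢ Q).filter fun pq => dist pq.1 pq.2 = 1).card : ℕ) : ℝ) := by
  classical
  rw [card_crossContacts_eq_sum_sum, card_crossContacts_eq_sum_sum,
    sum_image (σ.injective.injOn)]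
  refine sum_congr rfl fun p _ => ?_
  rw [sum_image (σ.injective.injOn)]
  refine sum_congr rfl fun q _ => ?_
  rw [LinearIsometryEquiv.dist_map]

/-! ## The inner-face bound, top clamp -/

/-- **The filling touches at most the inner face (top clamp).**  Mirror image of
`cross_le_innerFace_floor`: `X` lies at height `≤ b`, the complete sample `P` of `A·Λ₀ + t` fills
`[a, b] × disc ρ` (`b − a = R ≥ 3`, `ρ ≥ R`); then
`#{(p,q) ∈ P × (X \ P) : dist p q = 1} ≤ 2 φ(A⁻¹e₃) π ρ² + C ρ`. -/
theorem cross_le_innerFace_ceiling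
    (A : EuclideanSpace ℝ (Fin 3) ≃ₗᵢ[ℝ] EuclideanSpace ℝ (Fin 3)) (t : EuclideanSpace ℝ (Fin 3))
    (R : ℝ) (hR : 3 ≤ R) : ∃ C : ℝ, ∀ a b : ℝ, b - a = R → ∀ ρ : ℝ, R ≤ ρ →
      ∀ X P : Finset (EuclideanSpace ℝ (Fin 3)),
        (∀ p ∈ X, ∀ q ∈ X, p ≠ q → 1 ≤ dist p q) → P ⊆ X → (∀ q ∈ X, q 2 ≤ b) →
        (∀ p, p ∈ P ↔ (p ∈ (fun q => A q + t) '' fccStacking 1 (Real.sqrt (2 / 3)) ∧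
          a ≤ p 2 ∧ p 2 ≤ b ∧ p 0 ^ 2 + p 1 ^ 2 ≤ ρ ^ 2)) →
        ((((P ×ˢ (X \ P)).filter fun pq => dist pq.1 pq.2 = 1).card : ℕ) : ℝ) ≤
          2 * (Real.sqrt 2 / 4 * ∑ᶠ w ∈ {w ∈ fccStacking 1 (Real.sqrt (2 / 3)) | ‖w‖ = 1},
            |⟪w, A.symm (EuclideanSpace.single (2 : Fin 3) (1 : ℝ))⟫_ℝ|) * Real.pi * ρ ^ 2 +
            C * ρ := by
  classical
  set σ : EuclideanSpace ℝ (Fin 3) ≃ₗᵢ[ℝ] EuclideanSpace ℝ (Fin 3) :=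
    (ℝ ∙ EuclideanSpace.single (2 : Fin 3) (1 : ℝ))ᗮ.reflection with hσ
  have hσσ : ∀ v, σ (σ v) = v := fun v => Submodule.reflection_reflection _ v
  have hσ2 : ∀ v, (σ v) 2 = -v 2 := fun v => (reflection_e3_apply v).1
  have hσ0 : ∀ v, (σ v) 0 = v 0 := fun v => (reflection_e3_apply v).2.1
  have hσ1 : ∀ v, (σ v) 1 = v 1 := fun v => (reflection_e3_apply v).2.2
  obtain ⟨C, hC⟩ := cross_le_innerFace_floor (A.trans σ) (σ t) R hR
  refine ⟨C, ?_⟩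
  intro a b hab ρ hρ X P hX hPX hceil hP
  -- the mirrored configuration
  have hX' : ∀ p ∈ X.image σ, ∀ q ∈ X.image σ, p ≠ q → 1 ≤ dist p q := by
    intro p hp q hq hpq
    obtain ⟨p₀, hp₀, rfl⟩ := mem_image.1 hp
    obtain ⟨q₀, hq₀, rfl⟩ := mem_image.1 hq
    rw [LinearIsometryEquiv.dist_map]
    exact hX p₀ hp₀ q₀ hq₀ fun h => hpq (by rw [h])
  have hPX' : P.image σ ⊆ X.image σ := image_subset_image hPX
  have hfloor' : ∀ q ∈ X.image σ, -b ≤ q 2 := by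
    intro q hq
    obtain ⟨q₀, hq₀, rfl⟩ := mem_image.1 hq
    rw [hσ2]; linarith [hceil q₀ hq₀]
  have himgΛ : ∀ p, σ p ∈ (fun q => A q + t) '' fccStacking 1 (Real.sqrt (2 / 3)) ↔
      p ∈ (fun q => (A.trans σ) q + σ t) '' fccStacking 1 (Real.sqrt (2 / 3)) := by
    intro p
    constructor
    · rintro ⟨q, hq, hqp⟩
      refine ⟨q, hq, ?_⟩
      dsimp only at hqp ⊢
      rw [LinearIsometryEquiv.trans_apply, ← map_add, hqp, hσσ]
    · rintro ⟨q, hq, hqp⟩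
      refine ⟨q, hq, ?_⟩
      dsimp only at hqp ⊢
      rw [LinearIsometryEquiv.trans_apply, ← map_add] at hqp
      rw [← hqp, hσσ]
  have hP' : ∀ p, p ∈ P.image σ ↔
      (p ∈ (fun q => (A.trans σ) q + σ t) '' fccStacking 1 (Real.sqrt (2 / 3)) ∧
      -b ≤ p 2 ∧ p 2 ≤ -a ∧ p 0 ^ 2 + p 1 ^ 2 ≤ ρ ^ 2) := by
    intro p
    have hmem : p ∈ P.image σ ↔ σ p ∈ P := by
      rw [mem_image]
      constructor
      · rintro ⟨p₀, hp₀, rfl⟩; rw [hσσ]; exact hp₀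
      · intro h; exact ⟨σ p, h, hσσ p⟩
    rw [hmem, hP (σ p), himgΛ, hσ2, hσ0, hσ1]
    constructor
    · rintro ⟨h1, h2, h3, h4⟩; exact ⟨h1, by linarith, by linarith, h4⟩
    · rintro ⟨h1, h2, h3, h4⟩; exact ⟨h1, by linarith, by linarith, h4⟩
  have h := hC (-b) (-a) (by linarith) ρ hρ (X.image σ) (P.image σ) hX' hPX' hfloor' hP'
  -- undo the mirror
  rw [← image_sdiff _ _ σ.injective, card_crossContacts_image] at h
  have hν : (A.trans σ).symm (EuclideanSpace.single (2 : Fin 3) (1 : ℝ)) =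
      -A.symm (EuclideanSpace.single (2 : Fin 3) (1 : ℝ)) := by
    have : (A.trans σ).symm (EuclideanSpace.single (2 : Fin 3) (1 : ℝ)) =
        A.symm (σ.symm (EuclideanSpace.single (2 : Fin 3) (1 : ℝ))) := rfl
    rw [this, hσ, Submodule.reflection_symm, reflection_e3_single, map_neg]
  simp only [hν, inner_neg_right, abs_neg] at h
  exact h

/-! ## The filling pays for half of its cross contacts -/

/-- **Kissing bookkeeping.**  If `Y, Q ⊆ X` are disjoint and `X` is unit-separated then the
deficiency of `Y` is at least half its cross contacts with `Q`:
`#{(q, y) ∈ Q × Y : dist q y = 1} ≤ 2 D(Y)` (each `y` has at most twelve partners in `X`). -/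
theorem two_mul_contactDeficiency_ge_cross (X Y Q : Finset (EuclideanSpace ℝ (Fin 3)))
    (hX : ∀ p ∈ X, ∀ q ∈ X, p ≠ q → 1 ≤ dist p q) (hYX : Y ⊆ X) (hQX : Q ⊆ X)
    (hQY : Disjoint Q Y) :
    ((((Q ×ˢ Y).filter fun qy => dist qy.1 qy.2 = 1).card : ℕ) : ℝ) ≤ 2 * contactDeficiency Y := by
  classical
  -- both sides as sums over `y ∈ Y`
  have hcross : ((((Q ×ˢ Y).filter fun qy => dist qy.1 qy.2 = 1).card : ℕ) : ℝ) =
      ∑ y ∈ Y, ((Q.filter fun q => dist y q = 1).card : ℝ) := by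
    rw [card_crossContacts_eq_sum_sum, sum_comm]
    refine sum_congr rfl fun y _ => ?_
    rw [card_filter]
    push_cast
    refine sum_congr rfl fun q _ => ?_
    rw [dist_comm]
  have hD : 2 * contactDeficiency Y =
      ∑ y ∈ Y, (12 - ((Y.filter fun q => dist y q = 1).card : ℝ)) := by
    unfold contactDeficiency
    rw [orderedContacts_eq_sum_sum, sum_sub_distrib, sum_const, nsmul_eq_mul]
    have : ∑ y ∈ Y, ((Y.filter fun q => dist y q = 1).card : ℝ) =
        ∑ p ∈ Y, ∑ q ∈ Y, (if dist p q = 1 then (1 : ℝ) else 0) := by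
      refine sum_congr rfl fun y _ => ?_
      simp only [card_filter, Nat.cast_sum, Nat.cast_ite, Nat.cast_one, Nat.cast_zero]
    rw [this]; ring
  rw [hcross, hD]
  refine sum_le_sum fun y hy => ?_
  -- the partners of `y` in `Y` and in `Q` are disjoint sets of partners in `X`
  have hdisj : Disjoint (Y.filter fun q => dist y q = 1) (Q.filter fun q => dist y q = 1) :=
    disjoint_filter_filter hQY.symm
  have hsub : (Y.filter fun q => dist y q = 1) ∪ (Q.filter fun q => dist y q = 1) ⊆
      X.filter fun q => dist y q = 1 := by
    rw [← filter_union]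
    exact filter_subset_filter _ (union_subset hYX hQX)
  have h := (card_le_card hsub).trans (card_partners_le_twelve X hX y)
  rw [card_union_of_disjoint hdisj] at h
  have h' : ((Y.filter fun q => dist y q = 1).card : ℝ) +
      ((Q.filter fun q => dist y q = 1).card : ℝ) ≤ 12 := by exact_mod_cast h
  linarith

/-! ## Zero-charge two-slab adhesion -/

/-- **Zero-charge two-slab adhesion.**  For EVERY pair of moved fcc lattices
`Λᵢ = Aᵢ·Λ₀ + tᵢ` (co-axial or not) there are `C` and `R₀ = 3` such that in every clamped cylinder
cell the adhesion excess of the filling `Y = (X \ P₁) \ P₂` is at most the two inner faces: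
`cross(P₁, X \ P₁) + cross(P₂, Y) ≤ D(Y) + (φ₁ + φ₂) π ρ² + C (1 + h) ρ` — the registered stub
`TwoSlabAdhesion` with charge `0` in place of `1`. -/
theorem twoSlabAdhesion_zeroCharge
    (A₁ : EuclideanSpace ℝ (Fin 3) ≃ₗᵢ[ℝ] EuclideanSpace ℝ (Fin 3)) (t₁ : EuclideanSpace ℝ (Fin 3))
    (A₂ : EuclideanSpace ℝ (Fin 3) ≃ₗᵢ[ℝ] EuclideanSpace ℝ (Fin 3))
    (t₂ : EuclideanSpace ℝ (Fin 3)) :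
    ∃ C R₀ : ℝ, 1 ≤ R₀ ∧ ∀ h : ℝ, 0 ≤ h → ∀ ρ : ℝ, R₀ ≤ ρ →
      ∀ X P₁ P₂ : Finset (EuclideanSpace ℝ (Fin 3)),
      (∀ p ∈ X, ∀ q ∈ X, p ≠ q → 1 ≤ dist p q) → P₁ ⊆ X → P₂ ⊆ X \ P₁ →
      (∀ p ∈ X, -(2 * R₀) ≤ p 2 ∧ p 2 ≤ h + 2 * R₀ ∧ p 0 ^ 2 + p 1 ^ 2 ≤ ρ ^ 2) →
      (∀ p, p ∈ P₁ ↔ (p ∈ (fun q => A₁ q + t₁) '' fccStacking 1 (Real.sqrt (2 / 3)) ∧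
        -(2 * R₀) ≤ p 2 ∧ p 2 ≤ -R₀ ∧ p 0 ^ 2 + p 1 ^ 2 ≤ ρ ^ 2)) →
      (∀ p, p ∈ P₂ ↔ (p ∈ (fun q => A₂ q + t₂) '' fccStacking 1 (Real.sqrt (2 / 3)) ∧
        h + R₀ ≤ p 2 ∧ p 2 ≤ h + 2 * R₀ ∧ p 0 ^ 2 + p 1 ^ 2 ≤ ρ ^ 2)) →
      ((((P₁ ×ˢ (X \ P₁)).filter fun pq => dist pq.1 pq.2 = 1).card : ℕ) : ℝ) +
        ((((P₂ ×ˢ ((X \ P₁) \ P₂)).filter fun pq => dist pq.1 pq.2 = 1).card : ℕ) : ℝ) ≤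
        contactDeficiency ((X \ P₁) \ P₂) +
          (Real.sqrt 2 / 4 * ∑ᶠ w ∈ {w ∈ fccStacking 1 (Real.sqrt (2 / 3)) | ‖w‖ = 1},
              |⟪w, A₁.symm (EuclideanSpace.single (2 : Fin 3) (1 : ℝ))⟫_ℝ| +
            Real.sqrt 2 / 4 * ∑ᶠ w ∈ {w ∈ fccStacking 1 (Real.sqrt (2 / 3)) | ‖w‖ = 1},
              |⟪w, A₂.symm (EuclideanSpace.single (2 : Fin 3) (1 : ℝ))⟫_ℝ|) * Real.pi * ρ ^ 2 +
          C * (1 + h) * ρ := by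
  classical
  obtain ⟨C₁, hC₁⟩ := cross_le_innerFace_floor A₁ t₁ 3 le_rfl
  obtain ⟨C₂, hC₂⟩ := cross_le_innerFace_ceiling A₂ t₂ 3 le_rfl
  refine ⟨|C₁| + |C₂|, 3, by norm_num, ?_⟩
  intro h hh ρ hρ X P₁ P₂ hX hP₁X hP₂X₁ hcyl hP₁ hP₂
  set φ₁ : ℝ := Real.sqrt 2 / 4 * ∑ᶠ w ∈ {w ∈ fccStacking 1 (Real.sqrt (2 / 3)) | ‖w‖ = 1},
      |⟪w, A₁.symm (EuclideanSpace.single (2 : Fin 3) (1 : ℝ))⟫_ℝ| with hφ₁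
  set φ₂ : ℝ := Real.sqrt 2 / 4 * ∑ᶠ w ∈ {w ∈ fccStacking 1 (Real.sqrt (2 / 3)) | ‖w‖ = 1},
      |⟪w, A₂.symm (EuclideanSpace.single (2 : Fin 3) (1 : ℝ))⟫_ℝ| with hφ₂
  set Y := (X \ P₁) \ P₂ with hY
  have hP₂X : P₂ ⊆ X := hP₂X₁.trans sdiff_subset
  have hYX : Y ⊆ X := sdiff_subset.trans sdiff_subset
  -- (1) the two inner faces
  have h1 := hC₁ (-(2 * 3)) (-3) (by norm_num) ρ hρ X P₁ hX hP₁X (fun q hq => (hcyl q hq).1) hP₁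
  have h2 := hC₂ (h + 3) (h + 2 * 3) (by ring) ρ hρ X P₂ hX hP₂X (fun q hq => (hcyl q hq).2.1) hP₂
  -- (2) `cross(P₂, Y) ≤ cross(P₂, X \ P₂)` and `cross(P₁, X \ P₁) ≤ cross(P₁, Y)`
  have hYsub : Y ⊆ X \ P₂ := sdiff_subset_sdiff sdiff_subset (subset_refl _)
  have h2' : ((((P₂ ×ˢ Y).filter fun pq => dist pq.1 pq.2 = 1).card : ℕ) : ℝ) ≤
      ((((P₂ ×ˢ (X \ P₂)).filter fun pq => dist pq.1 pq.2 = 1).card : ℕ) : ℝ) := by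
    exact_mod_cast
      card_le_card (filter_subset_filter _ (product_subset_product (subset_refl _) hYsub))
  have h1' : ((((P₁ ×ˢ (X \ P₁)).filter fun pq => dist pq.1 pq.2 = 1).card : ℕ) : ℝ) ≤
      ((((P₁ ×ˢ Y).filter fun pq => dist pq.1 pq.2 = 1).card : ℕ) : ℝ) := by
    -- a partner of a bottom-sample ball is never a top-sample ball (heights `2R₀ + h` apart)
    refine Nat.cast_le.2 (card_le_card fun pq hpq => ?_)
    rw [mem_filter, mem_product] at hpq ⊢
    obtain ⟨⟨hp, hq⟩, hd⟩ := hpq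
    refine ⟨⟨hp, ?_⟩, hd⟩
    rw [hY, mem_sdiff]
    refine ⟨hq, fun hq₂ => ?_⟩
    have hpz := ((hP₁ pq.1).1 hp).2.2.1
    have hqz := ((hP₂ pq.2).1 hq₂).2.1
    have hsq := sq_sub_apply_le_dist_sq pq.2 pq.1 2
    rw [dist_comm, hd] at hsq
    nlinarith
  -- (3) the filling pays half of its cross contacts
  have hQ : Disjoint (P₁ ∪ P₂) Y := by
    rw [hY]
    exact disjoint_union_left.2 ⟨disjoint_sdiff.mono_right sdiff_subset, disjoint_sdiff⟩
  have h3 := two_mul_contactDeficiency_ge_cross X Y (P₁ ∪ P₂) hX hYX (union_subset hP₁X hP₂X) hQ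
  have hsplit : ((((P₁ ∪ P₂) ×ˢ Y).filter fun pq => dist pq.1 pq.2 = 1).card : ℝ) =
      ((((P₁ ×ˢ Y).filter fun pq => dist pq.1 pq.2 = 1).card : ℕ) : ℝ) +
        ((((P₂ ×ˢ Y).filter fun pq => dist pq.1 pq.2 = 1).card : ℕ) : ℝ) := by
    have hd12 : Disjoint P₁ P₂ := disjoint_sdiff.mono_right hP₂X₁
    rw [union_product, filter_union, card_union_of_disjoint]
    · push_cast; rfl
    · exact disjoint_filter_filter (disjoint_product.2 (Or.inl hd12))
  rw [hsplit] at h3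
  -- (4) assemble
  have hρ0 : 0 ≤ ρ := by linarith
  have ha : C₁ * ρ ≤ |C₁| * (1 + h) * ρ := by
    have h1 : C₁ * ρ ≤ |C₁| * ρ := mul_le_mul_of_nonneg_right (le_abs_self _) hρ0
    have h2 : 0 ≤ |C₁| * h * ρ := by positivity
    have h3 : |C₁| * (1 + h) * ρ = |C₁| * ρ + |C₁| * h * ρ := by ring
    linarith
  have hb : C₂ * ρ ≤ |C₂| * (1 + h) * ρ := by
    have h1 : C₂ * ρ ≤ |C₂| * ρ := mul_le_mul_of_nonneg_right (le_abs_self _) hρ0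
    have h2 : 0 ≤ |C₂| * h * ρ := by positivity
    have h3 : |C₂| * (1 + h) * ρ = |C₂| * ρ + |C₂| * h * ρ := by ring
    linarith
  have hnn : 0 ≤ (|C₁| + |C₂|) * (1 + h) * ρ := by positivity
  have hφ : (φ₁ + φ₂) * Real.pi * ρ ^ 2 = 1 / 2 * (2 * φ₁ * Real.pi * ρ ^ 2) +
      1 / 2 * (2 * φ₂ * Real.pi * ρ ^ 2) := by ring
  have hC : (|C₁| + |C₂|) * (1 + h) * ρ = |C₁| * (1 + h) * ρ + |C₂| * (1 + h) * ρ := by ring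
  rw [hφ, hC]
  linarith

/-! ## The zero-charge wall floor -/

/-- **Zero-charge wall floor.**  For every pair of moved fcc lattices there are `C` and `R₀ > 0`
such that every unit packing in the clamped cylinder cell of `GenericWallFloor` (all balls in
`[−2R₀, h + 2R₀] × disc ρ`, the two slab samples complete) has
`(φ(A₁⁻¹e₃) + φ(A₂⁻¹e₃)) π ρ² − C (1 + h) ρ ≤ 6 N − numContacts x`: the cell costs at least its
two OUTER free faces.  (The crux adds `+ 1 · π ρ²` for non-co-axial pairs.) -/
theorem genericWallFloor_zeroCharge
    (A₁ : EuclideanSpace ℝ (Fin 3) ≃ₗᵢ[ℝ] EuclideanSpace ℝ (Fin 3)) (t₁ : EuclideanSpace ℝ (Fin 3))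
    (A₂ : EuclideanSpace ℝ (Fin 3) ≃ₗᵢ[ℝ] EuclideanSpace ℝ (Fin 3))
    (t₂ : EuclideanSpace ℝ (Fin 3)) :
    ∃ C R₀ : ℝ, 0 < R₀ ∧ ∀ h : ℝ, 0 ≤ h → ∀ ρ : ℝ, R₀ ≤ ρ →
      ∀ (N : ℕ) (x : Fin N → EuclideanSpace ℝ (Fin 3)), IsUnitPacking x →
      (∀ i, -(2 * R₀) ≤ x i 2 ∧ x i 2 ≤ h + 2 * R₀ ∧ x i 0 ^ 2 + x i 1 ^ 2 ≤ ρ ^ 2) →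
      (∀ p ∈ (fun p => A₁ p + t₁) '' fccStacking 1 (Real.sqrt (2 / 3)),
        (-(2 * R₀) ≤ p 2 ∧ p 2 ≤ -R₀ ∧ p 0 ^ 2 + p 1 ^ 2 ≤ ρ ^ 2) → ∃ i, x i = p) →
      (∀ p ∈ (fun p => A₂ p + t₂) '' fccStacking 1 (Real.sqrt (2 / 3)),
        (h + R₀ ≤ p 2 ∧ p 2 ≤ h + 2 * R₀ ∧ p 0 ^ 2 + p 1 ^ 2 ≤ ρ ^ 2) → ∃ i, x i = p) →
      (Real.sqrt 2 / 4 * ∑ᶠ w ∈ {w ∈ fccStacking 1 (Real.sqrt (2 / 3)) | ‖w‖ = 1},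
          |⟪w, A₁.symm (EuclideanSpace.single (2 : Fin 3) (1 : ℝ))⟫_ℝ| +
        Real.sqrt 2 / 4 * ∑ᶠ w ∈ {w ∈ fccStacking 1 (Real.sqrt (2 / 3)) | ‖w‖ = 1},
          |⟪w, A₂.symm (EuclideanSpace.single (2 : Fin 3) (1 : ℝ))⟫_ℝ|) * Real.pi * ρ ^ 2 -
        C * (1 + h) * ρ ≤ 6 * (N : ℝ) - (numContacts x : ℝ) := by
  classical
  obtain ⟨C, R₀, hR₀, hadh⟩ := twoSlabAdhesion_zeroCharge A₁ t₁ A₂ t₂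
  have hS : Cruxes.GenericWallFloor.WallLedgerG.AffineSampleDeficit := stub_affineSampleDeficit
  obtain ⟨C₁, hC₁⟩ := hS A₁ t₁ R₀ hR₀
  obtain ⟨C₂, hC₂⟩ := hS A₂ t₂ R₀ hR₀
  refine ⟨|C| + |C₁| + |C₂|, R₀, by linarith, ?_⟩
  intro h hh ρ hρ N x hx hcyl hslab₁ hslab₂
  set φ₁ : ℝ := Real.sqrt 2 / 4 * ∑ᶠ w ∈ {w ∈ fccStacking 1 (Real.sqrt (2 / 3)) | ‖w‖ = 1},
      |⟪w, A₁.symm (EuclideanSpace.single (2 : Fin 3) (1 : ℝ))⟫_ℝ| with hφ₁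
  set φ₂ : ℝ := Real.sqrt 2 / 4 * ∑ᶠ w ∈ {w ∈ fccStacking 1 (Real.sqrt (2 / 3)) | ‖w‖ = 1},
      |⟪w, A₂.symm (EuclideanSpace.single (2 : Fin 3) (1 : ℝ))⟫_ℝ| with hφ₂
  have hxinj : Function.Injective x := hx.injective
  set X : Finset (EuclideanSpace ℝ (Fin 3)) := univ.image x with hX
  set P₁ : Finset (EuclideanSpace ℝ (Fin 3)) := X.filter fun p =>
    p ∈ (fun q => A₁ q + t₁) '' fccStacking 1 (Real.sqrt (2 / 3)) ∧
      -(2 * R₀) ≤ p 2 ∧ p 2 ≤ -R₀ ∧ p 0 ^ 2 + p 1 ^ 2 ≤ ρ ^ 2 with hP₁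
  set P₂ : Finset (EuclideanSpace ℝ (Fin 3)) := (X \ P₁).filter fun p =>
    p ∈ (fun q => A₂ q + t₂) '' fccStacking 1 (Real.sqrt (2 / 3)) ∧
      h + R₀ ≤ p 2 ∧ p 2 ≤ h + 2 * R₀ ∧ p 0 ^ 2 + p 1 ^ 2 ≤ ρ ^ 2 with hP₂
  have hXpack : ∀ p ∈ X, ∀ q ∈ X, p ≠ q → 1 ≤ dist p q := by
    intro p hp q hq hpq
    obtain ⟨i, -, rfl⟩ := mem_image.1 hp
    obtain ⟨j, -, rfl⟩ := mem_image.1 hq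
    exact hx.one_le_dist fun hij => hpq (by rw [hij])
  have hP₁X : P₁ ⊆ X := filter_subset _ _
  have hP₂X : P₂ ⊆ X \ P₁ := filter_subset _ _
  have hXcyl : ∀ p ∈ X, -(2 * R₀) ≤ p 2 ∧ p 2 ≤ h + 2 * R₀ ∧ p 0 ^ 2 + p 1 ^ 2 ≤ ρ ^ 2 := by
    intro p hp
    obtain ⟨i, -, rfl⟩ := mem_image.1 hp
    exact hcyl i
  have hP₁iff : ∀ p, p ∈ P₁ ↔ (p ∈ (fun q => A₁ q + t₁) '' fccStacking 1 (Real.sqrt (2 / 3)) ∧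
      -(2 * R₀) ≤ p 2 ∧ p 2 ≤ -R₀ ∧ p 0 ^ 2 + p 1 ^ 2 ≤ ρ ^ 2) := by
    intro p
    rw [hP₁, mem_filter]
    refine ⟨fun hp => hp.2, fun hp => ⟨?_, hp⟩⟩
    obtain ⟨i, hi⟩ := hslab₁ p hp.1 ⟨hp.2.1, hp.2.2.1, hp.2.2.2⟩
    exact mem_image.2 ⟨i, mem_univ _, hi⟩
  have hP₂iff : ∀ p, p ∈ P₂ ↔ (p ∈ (fun q => A₂ q + t₂) '' fccStacking 1 (Real.sqrt (2 / 3)) ∧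
      h + R₀ ≤ p 2 ∧ p 2 ≤ h + 2 * R₀ ∧ p 0 ^ 2 + p 1 ^ 2 ≤ ρ ^ 2) := by
    intro p
    rw [hP₂, mem_filter]
    refine ⟨fun hp => hp.2, fun hp => ⟨?_, hp⟩⟩
    obtain ⟨i, hi⟩ := hslab₂ p hp.1 ⟨hp.2.1, hp.2.2.1, hp.2.2.2⟩
    rw [mem_sdiff]
    refine ⟨mem_image.2 ⟨i, mem_univ _, hi⟩, fun hp1 => ?_⟩
    have h1 := ((hP₁iff p).1 hp1).2.2.1
    have h2 := hp.2.1
    linarith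
  -- the three inequalities and the two splits
  have hadh' := hadh h hh ρ hρ X P₁ P₂ hXpack hP₁X hP₂X hXcyl hP₁iff hP₂iff
  have hD₁ := hC₁ (-(2 * R₀)) (-R₀) (by ring) ρ hρ P₁ hP₁iff
  have hD₂ := hC₂ (h + R₀) (h + 2 * R₀) (by ring) ρ hρ P₂ hP₂iff
  have hsplit₁ := contactDeficiency_sdiff_split hP₁X
  have hsplit₂ := contactDeficiency_sdiff_split hP₂X
  have hDX : contactDeficiency X = 6 * (N : ℝ) - (numContacts x : ℝ) :=
    contactDeficiency_image_eq x hxinj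
  rw [← hDX]
  have hρ0 : (0 : ℝ) ≤ ρ := by linarith
  have h1h : (0 : ℝ) ≤ (1 + h) * ρ := by positivity
  have ha : C * (1 + h) * ρ ≤ |C| * (1 + h) * ρ := by
    have h1 : C * ((1 + h) * ρ) ≤ |C| * ((1 + h) * ρ) :=
      mul_le_mul_of_nonneg_right (le_abs_self _) h1h
    linarith [show C * (1 + h) * ρ = C * ((1 + h) * ρ) by ring,
      show |C| * (1 + h) * ρ = |C| * ((1 + h) * ρ) by ring]
  have hb : C₁ * ρ ≤ |C₁| * (1 + h) * ρ := by
    have h1 : C₁ * ρ ≤ |C₁| * ρ := mul_le_mul_of_nonneg_right (le_abs_self _) hρ0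
    have h2 : 0 ≤ |C₁| * h * ρ := by positivity
    have h3 : |C₁| * (1 + h) * ρ = |C₁| * ρ + |C₁| * h * ρ := by ring
    linarith
  have hc : C₂ * ρ ≤ |C₂| * (1 + h) * ρ := by
    have h1 : C₂ * ρ ≤ |C₂| * ρ := mul_le_mul_of_nonneg_right (le_abs_self _) hρ0
    have h2 : 0 ≤ |C₂| * h * ρ := by positivity
    have h3 : |C₂| * (1 + h) * ρ = |C₂| * ρ + |C₂| * h * ρ := by ring
    linarith
  linarith

end Summit.Ventures.Crystal3D.Theorems

end
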